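import Summits.RiemannHypothesis.RiemannHypothesis.Theorems.PfPersistenceThetaOddAutocorr
import HarnessLib

/-!
# PF-persistence cell — THE ODD FAR-LAG LEVEL-DROP LAW (G1.02 companion of `PfPersistenceAutocorrSplitLaw`)

Framing (page 1): mechanism/rigidity campaign; no RH claims.  Every `theorem` below is PROVED (kernel-checked,
RH-free, weight-free: any `Weights`, any window); the words DATA / CONJECTURE in docstrings mark what is NOT proved here.

The even law (`PfPersistenceAutocorrSplitLaw`, 06a91c08df81): a DOWN move that lowers the even ground level makes the even
ground state nodal.  This file is the ODD-sector companion at FAR lags, built on `PfPersistenceThetaOddAutocorr`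
(`form_oddBlock_dial_eq_oddAutocorr`: `vᵀQ⁻(dial p K w)v = vᵀQ⁻(w)v − 2(K−1)·w(p)·A⁻_v(log p)`; the far-lag sign lemma
`A⁻_v(y) ≤ 0` for `L/2 ≤ y ≤ L` when `θ⁻_v` is one-signed on `H = [0, L/2]`; floored: `A⁻_u(y) ≤ 2φN‖u‖²`).

THE LAW (window `(a, N)`, `L = 2a`, reached prime `p` at a FAR lag `a ≤ log p ≤ 2a`, UP dial `1 ≤ K`, `0 ≤ w(p)`):
if the up-dial LOWERS the odd ground level, `ε₁(Q⁻(dial p K w)) < ε₁(Q⁻(w))`, then EVERY bottom vector of the dialled odd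
block is NODAL on `H` (`farUpDial_not_mem_oddOneSignedAt_of_levelDrop`); floored version with the explicit margin
`4φN·(K−1)·w(p)` (`farUpDial_not_mem_floorNodelessOddAt_of_levelDrop`), hence rejection by the `eo` handle (`∩`, `.2`);
test-vector / threshold forms certifying the level drop from ONE positively-correlated test vector
(`oddLevelDrop_of_testVector`, `oddLevelDrop_of_threshold`, `farUpDial_not_mem_floorNodelessOddAt_of_threshold`); a `ζ`
handle; and the monotonicity corollary: below an odd-nodeless reference far DOWN-dials never raise the odd level
(`bottomRayleigh_farDownDial_le_of_mem_oddOneSignedAt`), with its falsifiable contrapositive; and the FAR UP-CONE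
version (several far primes raised at once, near primes untouched: `farUpCone_not_mem_oddOneSignedAt_of_levelDrop`, floored
`farUpCone_not_mem_floorNodelessOddAt_of_levelDrop` with margin `4φN·Σ_q (w' q − w q)`, via
the affine identity `form_oddBlock_eq_sub_sum_oddAutocorr`: `vᵀQ⁻(w')v = vᵀQ⁻(w)v − 2Σ_q (w' q − w q)·A⁻_v(log q)`).

NOT covered (CONJECTURE + DATA only): near lags `log p < a` (moves touching near primes), the even sector
along up-dials, and anything about `ζ`'s actual membership in the odd readers at any window.
-/

set_option linter.dupNamespace false

noncomputable section

namespace Summit.RiemannHypothesis.RiemannHypothesis.Theorems.PfPersistence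

open Real intervalIntegral MeasureTheory Matrix BigOperators Finset
open Summit.RiemannHypothesis.RiemannHypothesis.Theorems.PfPersistenceParityTransfer (thetaOdd)

/-! ## The law: a far up-dial that lowers the odd level makes the odd ground state nodal on `H` -/

/-- **PROVED — ODD FAR-LAG LEVEL-DROP LAW (raw reader).** Window `win`, reached prime `p` at a FAR lag
`win.a ≤ log p`, up-dial `1 ≤ K`, `0 ≤ w p`: if `ε₁(Q⁻(dial p K w)) < ε₁(Q⁻(w))` then NO bottom vector of the dialled odd
block is one-signed on `H`.  (Increment on a bottom vector `u`: `−2(K−1)w(p)A⁻_u(log p) < 0` by the level drop, but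
`≥ 0` if `u` were one-signed, §3.) [folklore] -/
theorem not_oneSignedOdd_of_farUpDial_levelDrop {win : Window} {p : ℕ} (hp : p ∈ primeRange (2 * win.a))
    (hfar : win.a ≤ Real.log p) {K : ℝ} (hK : 1 ≤ K) {w : Weights} (hw : 0 ≤ w p)
    (hdrop : bottomRayleigh (oddBlock (dial p K w) win) < bottomRayleigh (oddBlock w win))
    {u : Fin win.N → ℝ} (hu : IsBottomVector (oddBlock (dial p K w) win) u) : ¬ OneSignedOdd (2 * win.a) u := by
  intro hone
  have huu : 0 < u ⬝ᵥ u :=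
    lt_of_le_of_ne (dotProduct_self_nonneg_real u) fun h => hu.1 (dotProduct_self_eq_zero.1 h.symm)
  have h1 : u ⬝ᵥ (oddBlock (dial p K w) win *ᵥ u) = bottomRayleigh (oddBlock (dial p K w) win) * (u ⬝ᵥ u) := by
    rw [hu.2, dotProduct_smul, smul_eq_mul]
  have h2 := bottomRayleigh_mul_le_form (oddBlock w win) u
  have h3 := form_oddBlock_dial_eq_oddAutocorr hp K w u
  have hA := oddAutocorr_nonpos_of_oneSignedOdd_far hone (by linarith : 2 * win.a / 2 ≤ Real.log p)
    (log_le_of_mem_primeRange (by linarith [win.ha]) hp)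
  have h4 : 0 ≤ 2 * (K - 1) * w p * (-oddAutocorr (2 * win.a) u (Real.log p)) :=
    mul_nonneg (mul_nonneg (by linarith) hw) (by linarith)
  have h5 := mul_lt_mul_of_pos_right hdrop huu
  linarith

/-- **PROVED (reader form):** under the same hypotheses the dialled datum is REJECTED by the raw odd reader,
`datumOf (dial p K w) ∉ oddOneSignedAt win`. [folklore] -/
theorem farUpDial_not_mem_oddOneSignedAt_of_levelDrop {win : Window} {p : ℕ} (hp : p ∈ primeRange (2 * win.a))
    (hfar : win.a ≤ Real.log p) {K : ℝ} (hK : 1 ≤ K) {w : Weights} (hw : 0 ≤ w p)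
    (hdrop : bottomRayleigh (oddBlock (dial p K w) win) < bottomRayleigh (oddBlock w win)) :
    datumOf (dial p K w) ∉ oddOneSignedAt win := by
  rintro ⟨u, hu, hone⟩
  rw [oddDatum_datumOf] at hu
  exact not_oneSignedOdd_of_farUpDial_levelDrop hp hfar hK hw hdrop hu hone

/-- **PROVED — FLOORED ODD FAR-LAG LEVEL-DROP LAW.** With a floor `0 ≤ φ`: if the far up-dial lowers the odd level by MORE
than `4φ·N·(K−1)·w(p)`, then no bottom vector of the dialled odd block is `φ`-floor one-signed on `H`. [folklore] -/
theorem not_floorOneSignedOdd_of_farUpDial_levelDrop {win : Window} {p : ℕ} (hp : p ∈ primeRange (2 * win.a))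
    (hfar : win.a ≤ Real.log p) {K : ℝ} (hK : 1 ≤ K) {w : Weights} (hw : 0 ≤ w p) {φ : ℝ} (hφ : 0 ≤ φ)
    (hdrop : bottomRayleigh (oddBlock (dial p K w) win)
      < bottomRayleigh (oddBlock w win) - 4 * φ * win.N * ((K - 1) * w p))
    {u : Fin win.N → ℝ} (hu : IsBottomVector (oddBlock (dial p K w) win) u) :
    ¬ FloorOneSignedOdd (2 * win.a) φ u := by
  intro hfl
  have huu : 0 < u ⬝ᵥ u :=
    lt_of_le_of_ne (dotProduct_self_nonneg_real u) fun h => hu.1 (dotProduct_self_eq_zero.1 h.symm)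
  have h1 : u ⬝ᵥ (oddBlock (dial p K w) win *ᵥ u) = bottomRayleigh (oddBlock (dial p K w) win) * (u ⬝ᵥ u) := by
    rw [hu.2, dotProduct_smul, smul_eq_mul]
  have h2 := bottomRayleigh_mul_le_form (oddBlock w win) u
  have h3 := form_oddBlock_dial_eq_oddAutocorr hp K w u
  have hA := oddAutocorr_le_of_floorOneSignedOdd_far (by linarith [win.ha] : 0 < 2 * win.a) hφ hfl
    (by linarith : 2 * win.a / 2 ≤ Real.log p) (log_le_of_mem_primeRange (by linarith [win.ha]) hp)
  have hc : 0 ≤ 2 * (K - 1) * w p := mul_nonneg (by linarith) hw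
  have h4 := mul_le_mul_of_nonneg_left hA hc
  have h5 := mul_lt_mul_of_pos_right hdrop huu
  nlinarith

/-- **PROVED (floored reader form):** `datumOf (dial p K w) ∉ floorNodelessOddAt φ win` under the floored level drop.
At `φ = 0` this is the raw law. [folklore] -/
theorem farUpDial_not_mem_floorNodelessOddAt_of_levelDrop {win : Window} {p : ℕ} (hp : p ∈ primeRange (2 * win.a))
    (hfar : win.a ≤ Real.log p) {K : ℝ} (hK : 1 ≤ K) {w : Weights} (hw : 0 ≤ w p) {φ : ℝ} (hφ : 0 ≤ φ)
    (hdrop : bottomRayleigh (oddBlock (dial p K w) win)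
      < bottomRayleigh (oddBlock w win) - 4 * φ * win.N * ((K - 1) * w p)) :
    datumOf (dial p K w) ∉ floorNodelessOddAt φ win := by
  rintro ⟨u, hu, hfl⟩
  rw [oddDatum_datumOf] at hu
  exact not_floorOneSignedOdd_of_farUpDial_levelDrop hp hfar hK hw hφ hdrop hu hfl

/-- PROVED (the `eo` cell's handle, odd projection): the same hypotheses reject the dialled datum from
`floorNodelessEOAt φ win = floorNodelessAt φ win ∩ floorNodelessOddAt φ win`. [folklore] -/
theorem farUpDial_not_mem_floorNodelessEOAt_of_levelDrop {win : Window} {p : ℕ} (hp : p ∈ primeRange (2 * win.a))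
    (hfar : win.a ≤ Real.log p) {K : ℝ} (hK : 1 ≤ K) {w : Weights} (hw : 0 ≤ w p) {φ : ℝ} (hφ : 0 ≤ φ)
    (hdrop : bottomRayleigh (oddBlock (dial p K w) win)
      < bottomRayleigh (oddBlock w win) - 4 * φ * win.N * ((K - 1) * w p)) :
    datumOf (dial p K w) ∉ floorNodelessEOAt φ win :=
  fun h => farUpDial_not_mem_floorNodelessOddAt_of_levelDrop hp hfar hK hw hφ hdrop h.2

/-- **PROVED — THE ODD LEVEL DROP FROM ONE TEST VECTOR** (any dial value, any reached lag): if some `v ≠ 0` has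
`vᵀQ⁻(w)v − 2(K−1)w(p)A⁻_v(log p) < ε₁(Q⁻(w))·‖v‖²` then `ε₁(Q⁻(dial p K w)) < ε₁(Q⁻(w))`. [folklore] -/
theorem oddLevelDrop_of_testVector {win : Window} {p : ℕ} (hp : p ∈ primeRange (2 * win.a)) (K : ℝ) (w : Weights)
    {v : Fin win.N → ℝ} (hv : v ≠ 0)
    (hlt : v ⬝ᵥ (oddBlock w win *ᵥ v) - 2 * (K - 1) * w p * oddAutocorr (2 * win.a) v (Real.log p)
      < bottomRayleigh (oddBlock w win) * (v ⬝ᵥ v)) :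
    bottomRayleigh (oddBlock (dial p K w) win) < bottomRayleigh (oddBlock w win) := by
  have hvv : 0 < v ⬝ᵥ v :=
    lt_of_le_of_ne (dotProduct_self_nonneg_real v) fun h => hv (dotProduct_self_eq_zero.1 h.symm)
  have h := bottomRayleigh_mul_le_form (oddBlock (dial p K w) win) v
  rw [form_oddBlock_dial_eq_oddAutocorr hp K w v] at h
  exact lt_of_mul_lt_mul_right (h.trans_lt hlt) hvv.le

/-- **PROVED — THRESHOLD FORM.** A test vector `v ≠ 0` with Rayleigh bound `vᵀQ⁻(w)v ≤ ℓ‖v‖²` and POSITIVE odd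
correlation `τ‖v‖² ≤ A⁻_v(log p)` certifies the odd level drop along the up-dial as soon as
`ℓ − ε₁(Q⁻(w)) < 2(K−1)·w(p)·τ` (`1 ≤ K`, `0 ≤ w p`). [folklore] -/
theorem oddLevelDrop_of_threshold {win : Window} {p : ℕ} (hp : p ∈ primeRange (2 * win.a)) {K : ℝ} (hK : 1 ≤ K)
    {w : Weights} (hw : 0 ≤ w p) {v : Fin win.N → ℝ} (hv : v ≠ 0) {ℓ τ : ℝ}
    (hℓ : v ⬝ᵥ (oddBlock w win *ᵥ v) ≤ ℓ * (v ⬝ᵥ v)) (hτ : τ * (v ⬝ᵥ v) ≤ oddAutocorr (2 * win.a) v (Real.log p))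
    (ht : ℓ - bottomRayleigh (oddBlock w win) < 2 * (K - 1) * w p * τ) :
    bottomRayleigh (oddBlock (dial p K w) win) < bottomRayleigh (oddBlock w win) := by
  refine oddLevelDrop_of_testVector hp K w hv ?_
  have hvv : 0 < v ⬝ᵥ v :=
    lt_of_le_of_ne (dotProduct_self_nonneg_real v) fun h => hv (dotProduct_self_eq_zero.1 h.symm)
  have hc : 0 ≤ 2 * (K - 1) * w p := mul_nonneg (by linarith) hw
  have h1 := mul_le_mul_of_nonneg_left hτ hc
  have h2 := mul_lt_mul_of_pos_right ht hvv
  nlinarith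

/-- **PROVED — THRESHOLD ⇒ REJECTION at a far lag (floored).** With `win.a ≤ log p` and the sharper threshold
`ℓ − ε₁(Q⁻(w)) < 2(K−1)·w(p)·(τ − 2φN)`, the dialled datum is rejected by `floorNodelessOddAt φ win` (and by the `eo`
handle).  At `φ = 0`: `oddLevelDrop_of_threshold` + `farUpDial_not_mem_oddOneSignedAt_of_levelDrop`. [folklore] -/
theorem farUpDial_not_mem_floorNodelessOddAt_of_threshold {win : Window} {p : ℕ} (hp : p ∈ primeRange (2 * win.a))
    (hfar : win.a ≤ Real.log p) {K : ℝ} (hK : 1 ≤ K) {w : Weights} (hw : 0 ≤ w p) {φ : ℝ} (hφ : 0 ≤ φ)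
    {v : Fin win.N → ℝ} (hv : v ≠ 0) {ℓ τ : ℝ} (hℓ : v ⬝ᵥ (oddBlock w win *ᵥ v) ≤ ℓ * (v ⬝ᵥ v))
    (hτ : τ * (v ⬝ᵥ v) ≤ oddAutocorr (2 * win.a) v (Real.log p))
    (ht : ℓ - bottomRayleigh (oddBlock w win) < 2 * (K - 1) * w p * (τ - 2 * φ * win.N)) :
    datumOf (dial p K w) ∉ floorNodelessOddAt φ win := by
  refine farUpDial_not_mem_floorNodelessOddAt_of_levelDrop hp hfar hK hw hφ ?_
  have hvv : 0 < v ⬝ᵥ v :=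
    lt_of_le_of_ne (dotProduct_self_nonneg_real v) fun h => hv (dotProduct_self_eq_zero.1 h.symm)
  have h := bottomRayleigh_mul_le_form (oddBlock (dial p K w) win) v
  rw [form_oddBlock_dial_eq_oddAutocorr hp K w v] at h
  have hc : 0 ≤ 2 * (K - 1) * w p := mul_nonneg (by linarith) hw
  have h1 := mul_le_mul_of_nonneg_left hτ hc
  have h2 := mul_lt_mul_of_pos_right ht hvv
  have h3 : bottomRayleigh (oddBlock (dial p K w) win) * (v ⬝ᵥ v)
      < (bottomRayleigh (oddBlock w win) - 4 * φ * win.N * ((K - 1) * w p)) * (v ⬝ᵥ v) := by nlinarith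
  exact lt_of_mul_lt_mul_right h3 hvv.le

/-- PROVED (`ζ` handle): for `zetaWeights` (`0 ≤ w p` automatic) a far up-dial whose floored odd level drop holds at `win`
— a per-window premise that is DATA wherever it is asserted — is rejected by `floorNodelessOddAt φ win`.  Nothing here
asserts the premise for any actual `(p, K, win)`. [folklore] -/
theorem zeta_farUpDial_not_mem_floorNodelessOddAt_of_levelDrop {win : Window} {p : ℕ}
    (hp : p ∈ primeRange (2 * win.a)) (hfar : win.a ≤ Real.log p) {K : ℝ} (hK : 1 ≤ K) {φ : ℝ} (hφ : 0 ≤ φ)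
    (hdrop : bottomRayleigh (oddBlock (dial p K zetaWeights) win)
      < bottomRayleigh (oddBlock zetaWeights win) - 4 * φ * win.N * ((K - 1) * zetaWeights p)) :
    datumOf (dial p K zetaWeights) ∉ floorNodelessOddAt φ win :=
  farUpDial_not_mem_floorNodelessOddAt_of_levelDrop hp hfar hK (zetaWeights_nonneg p) hφ hdrop

/-- **PROVED — MONOTONICITY BELOW AN ODD-NODELESS REFERENCE.** If the reference table's odd block at `win` has a bottom
vector one-signed on `H` (`datumOf w ∈ oddOneSignedAt win`), then every far DOWN-dial (`K ≤ 1`, `0 ≤ w p`,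
`win.a ≤ log p`) satisfies `ε₁(Q⁻(dial p K w)) ≤ ε₁(Q⁻(w))`: far down-dials never RAISE the odd level.  (For `ζ` the
premise is DATA per window.) [folklore] -/
theorem bottomRayleigh_farDownDial_le_of_mem_oddOneSignedAt {win : Window} {p : ℕ} (hp : p ∈ primeRange (2 * win.a))
    (hfar : win.a ≤ Real.log p) {K : ℝ} (hK : K ≤ 1) {w : Weights} (hw : 0 ≤ w p)
    (hmem : datumOf w ∈ oddOneSignedAt win) :
    bottomRayleigh (oddBlock (dial p K w) win) ≤ bottomRayleigh (oddBlock w win) := by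
  obtain ⟨u, hu, hone⟩ := hmem
  rw [oddDatum_datumOf] at hu
  have huu : 0 < u ⬝ᵥ u :=
    lt_of_le_of_ne (dotProduct_self_nonneg_real u) fun h => hu.1 (dotProduct_self_eq_zero.1 h.symm)
  have h1 : u ⬝ᵥ (oddBlock w win *ᵥ u) = bottomRayleigh (oddBlock w win) * (u ⬝ᵥ u) := by
    rw [hu.2, dotProduct_smul, smul_eq_mul]
  have h := bottomRayleigh_mul_le_form (oddBlock (dial p K w) win) u
  rw [form_oddBlock_dial_eq_oddAutocorr hp K w u, h1] at h
  have hA := oddAutocorr_nonpos_of_oneSignedOdd_far hone (by linarith : 2 * win.a / 2 ≤ Real.log p)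
    (log_le_of_mem_primeRange (by linarith [win.ha]) hp)
  have h4 : 0 ≤ 2 * (1 - K) * w p * (-oddAutocorr (2 * win.a) u (Real.log p)) :=
    mul_nonneg (mul_nonneg (by linarith) hw) (by linarith)
  exact le_of_mul_le_mul_right (by nlinarith) huu

/-- PROVED (contrapositive, a falsifiable reading): a far DOWN-dial that RAISES the odd level at `win` certifies that the
REFERENCE's odd block has NO one-signed bottom vector on `H` there, `datumOf w ∉ oddOneSignedAt win`. [folklore] -/
theorem not_mem_oddOneSignedAt_of_farDownDial_levelRaise {win : Window} {p : ℕ} (hp : p ∈ primeRange (2 * win.a))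
    (hfar : win.a ≤ Real.log p) {K : ℝ} (hK : K ≤ 1) {w : Weights} (hw : 0 ≤ w p)
    (hraise : bottomRayleigh (oddBlock w win) < bottomRayleigh (oddBlock (dial p K w) win)) :
    datumOf w ∉ oddOneSignedAt win :=
  fun hmem => (not_lt.2 (bottomRayleigh_farDownDial_le_of_mem_oddOneSignedAt hp hfar hK hw hmem)) hraise

/-! ## The far up-cone (several far primes raised at once) -/

/-- PROVED (the odd block is affine in the weights): `Q⁻(w') = Q⁻(w) − Σ_{q ∈ primeRange 2a} (2(w' q − w q)) • P⁻_q`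
(polar and archimedean parts cancel; companion of `evenBlock_form_sub`). [folklore] -/
theorem oddBlock_eq_sub_sum_smul (w w' : Weights) (win : Window) :
    oddBlock w' win = oddBlock w win - ∑ q ∈ primeRange (2 * win.a), (2 * (w' q - w q)) • oddPrimePattern q win := by
  ext i j
  simp only [oddBlock, weil, WP, oddPrimePattern, Matrix.sub_apply, Matrix.sum_apply, Matrix.smul_apply, smul_eq_mul]
  have h : ∑ q ∈ primeRange (2 * win.a),
      2 * (w' q - w q) * thetaOdd (2 * win.a) ((i : ℕ) + 1) ((j : ℕ) + 1) (Real.log q)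
      = 2 * ∑ q ∈ primeRange (2 * win.a), w' q * thetaOdd (2 * win.a) ((i : ℕ) + 1) ((j : ℕ) + 1) (Real.log q)
        - 2 * ∑ q ∈ primeRange (2 * win.a), w q * thetaOdd (2 * win.a) ((i : ℕ) + 1) ((j : ℕ) + 1) (Real.log q) := by
    rw [Finset.mul_sum, Finset.mul_sum, ← Finset.sum_sub_distrib]
    exact Finset.sum_congr rfl fun q _ => by ring
  rw [h]
  ring

/-- **PROVED — THE ODD FORM IS AFFINE ALONG ANY MOVE:** `vᵀQ⁻(w')v = vᵀQ⁻(w)v − 2 Σ_{q ∈ primeRange 2a} (w' q − w q)·A⁻_v(log q)`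
(every table `w'` against every reference `w`; companion of `form_eq_form_add_sum_autocorr`). [folklore] -/
theorem form_oddBlock_eq_sub_sum_oddAutocorr (w w' : Weights) (win : Window) (v : Fin win.N → ℝ) :
    v ⬝ᵥ (oddBlock w' win *ᵥ v) = v ⬝ᵥ (oddBlock w win *ᵥ v)
      - 2 * ∑ q ∈ primeRange (2 * win.a), (w' q - w q) * oddAutocorr (2 * win.a) v (Real.log q) := by
  rw [oddBlock_eq_sub_sum_smul w w' win, Matrix.sub_mulVec, dotProduct_sub, Matrix.sum_mulVec, dotProduct_sum,
    Finset.mul_sum]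
  congr 1
  refine Finset.sum_congr rfl fun q _ => ?_
  rw [Matrix.smul_mulVec, dotProduct_smul, smul_eq_mul, oddPrimePattern_form_eq_oddAutocorr win.ha]
  ring

/-- **PROVED — FAR UP-CONE LEVEL-DROP LAW.** Let `w'` lie ABOVE the reference `w` at the window's reached primes
(`w q ≤ w' q`) and AGREE with it at the NEAR ones (`log q < a ⇒ w' q = w q`) — i.e. `w'` raises weights only at far
primes `a ≤ log q ≤ 2a`, any number of them.  If `ε₁(Q⁻(w')) < ε₁(Q⁻(w))` then no bottom vector of `Q⁻(w')` is
one-signed on `H`. [folklore] -/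
theorem not_oneSignedOdd_of_farUpCone_levelDrop {win : Window} {w w' : Weights}
    (hle : ∀ q ∈ primeRange (2 * win.a), w q ≤ w' q)
    (hnear : ∀ q ∈ primeRange (2 * win.a), Real.log q < win.a → w' q = w q)
    (hdrop : bottomRayleigh (oddBlock w' win) < bottomRayleigh (oddBlock w win))
    {u : Fin win.N → ℝ} (hu : IsBottomVector (oddBlock w' win) u) : ¬ OneSignedOdd (2 * win.a) u := by
  intro hone
  have huu : 0 < u ⬝ᵥ u :=
    lt_of_le_of_ne (dotProduct_self_nonneg_real u) fun h => hu.1 (dotProduct_self_eq_zero.1 h.symm)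
  have h1 : u ⬝ᵥ (oddBlock w' win *ᵥ u) = bottomRayleigh (oddBlock w' win) * (u ⬝ᵥ u) := by
    rw [hu.2, dotProduct_smul, smul_eq_mul]
  have h2 := bottomRayleigh_mul_le_form (oddBlock w win) u
  have h3 := form_oddBlock_eq_sub_sum_oddAutocorr w w' win u
  have hS : ∑ q ∈ primeRange (2 * win.a), (w' q - w q) * oddAutocorr (2 * win.a) u (Real.log q) ≤ 0 := by
    refine Finset.sum_nonpos fun q hq => ?_
    by_cases hfar : win.a ≤ Real.log q
    · exact mul_nonpos_of_nonneg_of_nonpos (sub_nonneg.2 (hle q hq))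
        (oddAutocorr_nonpos_of_oneSignedOdd_far hone (by linarith) (log_le_of_mem_primeRange (by linarith [win.ha]) hq))
    · rw [hnear q hq (not_le.1 hfar), sub_self, zero_mul]
  have h5 := mul_lt_mul_of_pos_right hdrop huu
  linarith

/-- **PROVED (reader form):** a far up-cone table that lowers the odd level at `win` is rejected by the raw odd reader,
`datumOf w' ∉ oddOneSignedAt win`. [folklore] -/
theorem farUpCone_not_mem_oddOneSignedAt_of_levelDrop {win : Window} {w w' : Weights}
    (hle : ∀ q ∈ primeRange (2 * win.a), w q ≤ w' q)
    (hnear : ∀ q ∈ primeRange (2 * win.a), Real.log q < win.a → w' q = w q)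
    (hdrop : bottomRayleigh (oddBlock w' win) < bottomRayleigh (oddBlock w win)) :
    datumOf w' ∉ oddOneSignedAt win := by
  rintro ⟨u, hu, hone⟩
  rw [oddDatum_datumOf] at hu
  exact not_oneSignedOdd_of_farUpCone_levelDrop hle hnear hdrop hu hone

/-- **PROVED — FLOORED FAR UP-CONE LAW.** With a floor `0 ≤ φ`: if a far up-cone table `w'` (above `w` at the reached
primes, equal to `w` at the near ones) lowers the odd level by more than `4φN·Σ_q (w' q − w q)`, then no bottom vector of
`Q⁻(w')` is `φ`-floor one-signed on `H`. [folklore] -/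
theorem not_floorOneSignedOdd_of_farUpCone_levelDrop {win : Window} {w w' : Weights}
    (hle : ∀ q ∈ primeRange (2 * win.a), w q ≤ w' q)
    (hnear : ∀ q ∈ primeRange (2 * win.a), Real.log q < win.a → w' q = w q) {φ : ℝ} (hφ : 0 ≤ φ)
    (hdrop : bottomRayleigh (oddBlock w' win)
      < bottomRayleigh (oddBlock w win) - 4 * φ * win.N * ∑ q ∈ primeRange (2 * win.a), (w' q - w q))
    {u : Fin win.N → ℝ} (hu : IsBottomVector (oddBlock w' win) u) : ¬ FloorOneSignedOdd (2 * win.a) φ u := by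
  intro hfl
  have huu : 0 < u ⬝ᵥ u :=
    lt_of_le_of_ne (dotProduct_self_nonneg_real u) fun h => hu.1 (dotProduct_self_eq_zero.1 h.symm)
  have h1 : u ⬝ᵥ (oddBlock w' win *ᵥ u) = bottomRayleigh (oddBlock w' win) * (u ⬝ᵥ u) := by
    rw [hu.2, dotProduct_smul, smul_eq_mul]
  have h2 := bottomRayleigh_mul_le_form (oddBlock w win) u
  have h3 := form_oddBlock_eq_sub_sum_oddAutocorr w w' win u
  have hS : ∑ q ∈ primeRange (2 * win.a), (w' q - w q) * oddAutocorr (2 * win.a) u (Real.log q)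
      ≤ ∑ q ∈ primeRange (2 * win.a), (w' q - w q) * (2 * φ * win.N * (u ⬝ᵥ u)) := by
    refine Finset.sum_le_sum fun q hq => ?_
    by_cases hfar : win.a ≤ Real.log q
    · exact mul_le_mul_of_nonneg_left
        (oddAutocorr_le_of_floorOneSignedOdd_far (by linarith [win.ha] : 0 < 2 * win.a) hφ hfl (by linarith)
          (log_le_of_mem_primeRange (by linarith [win.ha]) hq)) (sub_nonneg.2 (hle q hq))
    · rw [hnear q hq (not_le.1 hfar), sub_self, zero_mul, zero_mul]
  rw [← Finset.sum_mul] at hS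
  have h5 := mul_lt_mul_of_pos_right hdrop huu
  nlinarith

/-- **PROVED (floored reader form):** a far up-cone table with the floored odd level drop at `win` is rejected by
`floorNodelessOddAt φ win` (at `φ = 0`: `farUpCone_not_mem_oddOneSignedAt_of_levelDrop`). [folklore] -/
theorem farUpCone_not_mem_floorNodelessOddAt_of_levelDrop {win : Window} {w w' : Weights}
    (hle : ∀ q ∈ primeRange (2 * win.a), w q ≤ w' q)
    (hnear : ∀ q ∈ primeRange (2 * win.a), Real.log q < win.a → w' q = w q) {φ : ℝ} (hφ : 0 ≤ φ)
    (hdrop : bottomRayleigh (oddBlock w' win)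
      < bottomRayleigh (oddBlock w win) - 4 * φ * win.N * ∑ q ∈ primeRange (2 * win.a), (w' q - w q)) :
    datumOf w' ∉ floorNodelessOddAt φ win := by
  rintro ⟨u, hu, hfl⟩
  rw [oddDatum_datumOf] at hu
  exact not_floorOneSignedOdd_of_farUpCone_levelDrop hle hnear hφ hdrop hu hfl

end Summit.RiemannHypothesis.RiemannHypothesis.Theorems.PfPersistence

end
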